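import Literature.Topology.FourManifolds.SlideSetup2
import Literature.Topology.FourManifolds.SlideCurveGlue
import HarnessLib

/-!
# The slid circle in the slab, II: the far side of the push-off (continuous angle lift, height decreasing)

Topic `Literature/Topology/FourManifolds`; fact seat `provefact-IsStrictHandleSlide.isSurgery`
(R. C. Kirby, *The Topology of 4-Manifolds*, LNM 1374 (1989), Ch. I §4, Fig. 4.2; remaining content:
the named fact (S) `Literature.Topology.FourManifolds.FramedLink.IsStrictHandleSlide.slideModel`).
Between its two landings `t_L` (lower) and `t_Lᵘ' = -t_Lᵘ` (upper) the slid circle `K₂` runs ON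
the push-off `P`, the far way round. Along the knot parameter its slice angle relative to the
axis has the **continuous lift** `θP` (`BandCore.SlideChoice.θP`), glued from three formulas
that agree on overlaps: `ΘB (H₁ˡᵒ t) - φ` (end of the lower track, `H₁ˡᵒ = g_lo = heightB ∘ ψ`
there), `2π ψ t - φ` (the `B`-piece of the rebuilt knot) and `2π + ΘB (1 - H₁ᵘ (-t)) - φ` (start
of the upper track). `θP` has positive derivative, increases from `θ₁ = Rlo.θ t_L ∈ (0, π)` to
`θ₂ = 2π - Rup.θ t_Lᵘ ∈ (π, 2π)`, the twisted abscissa is negative at both ends (the landings lie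
past the vertical, `RouteHyp.α_tL_mem`) hence on the whole arc (`SlideCurveGlue`), so the
twisted height `yP = sliceY tw 1 (cos θP) (sin θP)` has negative derivative and is strictly
decreasing on `[t_L, t_Lᵘ']` (`yP_strictAnti`).

## References

* R. C. Kirby, *The Topology of 4-Manifolds*, LNM 1374, Springer (1989), Ch. I §4. [Kirby1989]
-/

open scoped Topology ContDiff
open Set Real Filter

noncomputable section

namespace Literature.Topology.FourManifolds

namespace BandCore

variable {A B : Knot} {avoid : Set (Metric.sphere (0 : EuclideanSpace ℝ (Fin 4)) 1)} {c : BandCore A B avoid}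

/-- `ΘB (heightB s) = 2π s` on the range of `thetaB`. [folklore] -/
theorem ΘB_heightB (c : BandCore A B avoid) {s : ℝ} (hs : s ∈ Icc (c.thetaB (9 / 10)) (c.thetaB 10⁻¹)) :
    c.ΘB (c.heightB s) = 2 * π * s := by
  show 2 * π * c.thetaB (c.heightB s) = 2 * π * s
  rw [(c.thetaB_heightB hs).1]

/-- `deriv ΘB < 0` on the open window. [folklore] -/
theorem deriv_ΘB_neg (c : BandCore A B avoid) {h : ℝ} (hh : h ∈ Ioo (10⁻¹ : ℝ) (9 / 10)) : deriv c.ΘB h < 0 := by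
  have : c.ΘB = fun y ↦ 2 * π * c.thetaB y := rfl
  rw [this, deriv_const_mul _ ((c.contDiffOn_thetaB.differentiableOn (by simp)).differentiableAt (Ioo_mem_nhds hh.1 hh.2))]
  exact mul_neg_of_pos_of_neg (by positivity) (c.deriv_thetaB_neg hh)

/-- `hasDerivAt_ΘB` (auxiliary). [folklore] -/
theorem hasDerivAt_ΘB (c : BandCore A B avoid) {h : ℝ} (hh : h ∈ Ioo (10⁻¹ : ℝ) (9 / 10)) :
    HasDerivAt c.ΘB (deriv c.ΘB h) h :=
  (((contDiffOn_ΘB c).differentiableOn (by simp)).differentiableAt (Ioo_mem_nhds hh.1 hh.2)).hasDerivAt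

namespace SlideChoice

variable {e : ℝ → ℝ} (P : c.SlideChoice e) (he : ContDiffOn ℝ ∞ e (Ioo (10⁻¹ : ℝ) (9 / 10)))

/-! ### The three angle formulas and their agreement -/

/-- The relative slice angle at the end of the lower track. [folklore] -/
def θPlo (t : ℝ) : ℝ := c.ΘB (P.dl.H₁ t) - P.φ

/-- The relative slice angle on the `B`-piece of the rebuilt knot (continuous lift). [folklore] -/
def θPmid (t : ℝ) : ℝ := 2 * π * c.psi t - P.φ

/-- The relative slice angle at the start of the upper track (continuous lift, `+2π`). [folklore] -/
def θPup (t : ℝ) : ℝ := 2 * π + c.ΘB (1 - P.du.H₁ (-t)) - P.φ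

/-- **The continuous lift of the relative slice angle along the far side.** [folklore] -/
def θP (t : ℝ) : ℝ :=
  if t ≤ c.tlo - c.epsLo then P.θPlo t else if t ≤ c.thi + c.epsHi then P.θPmid t else P.θPup t

/-- The upper landing parameter `t_Lᵘ' = -t_Lᵘ`. [folklore] -/
def tLu' : ℝ := -P.du.tL

/-- `dl_b` (auxiliary). [folklore] -/
theorem dl_b : P.dl.b = c.tlo - c.epsLo := rfl
/-- `dl_ε` (auxiliary). [folklore] -/
theorem dl_ε : P.dl.ε = c.epsLo := rfl
/-- `dl_a` (auxiliary). [folklore] -/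
theorem dl_a : P.dl.a = c.alo + c.epsLo := rfl
/-- `du_b` (auxiliary). [folklore] -/
theorem du_b : P.du.b = -c.thi - c.epsHi := rfl
/-- `du_ε` (auxiliary). [folklore] -/
theorem du_ε : P.du.ε = c.epsHi := rfl
/-- `du_a` (auxiliary). [folklore] -/
theorem du_a : P.du.a = -c.ahi + c.epsHi := rfl
/-- `dl_g` (auxiliary). [folklore] -/
theorem dl_g : P.dl.g = c.gLo := rfl
/-- `du_g` (auxiliary). [folklore] -/
theorem du_g : P.du.g = c.gUpR := rfl

/-- `tL_mem` (auxiliary). [folklore] -/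
theorem tL_mem : P.dl.tL ∈ Ioo (c.tlo - 2 * c.epsLo) (c.tlo - 3 * c.epsLo / 2) := by
  have h := P.dl.tL_mem; rw [dl_b, dl_ε] at h; exact ⟨by linarith [h.1], by linarith [h.2]⟩

/-- `tLu'_mem` (auxiliary). [folklore] -/
theorem tLu'_mem : P.tLu' ∈ Ioo (c.thi + 3 * c.epsHi / 2) (c.thi + 2 * c.epsHi) := by
  have h := P.du.tL_mem; rw [du_b, du_ε] at h; rw [tLu']; exact ⟨by linarith [h.2], by linarith [h.1]⟩

/-- **Agreement on the lower overlap** `[tlo - 3ε/2, tlo - ε/4]`. [folklore] -/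
theorem θPlo_eq_θPmid {t : ℝ} (ht : t ∈ Icc (c.tlo - 3 * c.epsLo / 2) (c.tlo - c.epsLo / 4)) : P.θPlo t = P.θPmid t := by
  have hε := c.epsLo_pos'
  have h1 : P.dl.H₁ t = c.gLo t := by rw [P.dl.H₁_of_ge (by rw [dl_b, dl_ε]; linarith [ht.1]), dl_g]
  have hl := c.psiInv_le_landing
  have hm := c.tlo_marksB.1
  have h2 : c.gLo t = c.heightB (c.psi t) := c.gLo_spec.2.1 t ⟨by linarith [ht.1], by linarith [ht.2]⟩
  have hpsi : c.psi t ∈ Icc (c.thetaB (9 / 10)) (c.thetaB 10⁻¹) := by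
    constructor
    · have a1 : c.thetaB (9 / 10) ≤ c.thetaB (7 / 20) := c.strictAntiOn_thetaB.antitoneOn (by norm_num) (by norm_num) (by norm_num)
      have a2 : c.psi (c.psiInv (c.thetaB (7 / 20))) ≤ c.psi t := c.strictMono_psi.monotone (by linarith [ht.1])
      rw [c.psi_psiInv] at a2; linarith
    · have a1 : c.thetaB (1 / 5) ≤ c.thetaB 10⁻¹ := c.strictAntiOn_thetaB.antitoneOn (by norm_num) (by norm_num) (by norm_num)
      have a2 : c.psi t ≤ c.psi c.tlo := c.strictMono_psi.monotone (by linarith [ht.2])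
      rw [c.psi_tlo] at a2; linarith
  rw [θPlo, θPmid, h1, h2, c.ΘB_heightB hpsi]

/-- **Agreement on the upper overlap** `[thi + ε'/4, thi + 3ε'/2]`. [folklore] -/
theorem θPmid_eq_θPup {t : ℝ} (ht : t ∈ Icc (c.thi + c.epsHi / 4) (c.thi + 3 * c.epsHi / 2)) : P.θPmid t = P.θPup t := by
  have hε := c.epsHi_bounds.1
  have h1 : P.du.H₁ (-t) = c.gUpR (-t) := by rw [P.du.H₁_of_ge (by rw [du_b, du_ε]; linarith [ht.2]), du_g]
  have hm := c.thi_marksB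
  have h2 : c.gUp t = c.heightB (c.psi t - 1) := c.gUp_spec.2.1 t ⟨by linarith [ht.1, hm.1], by linarith [ht.2, hm.2]⟩
  have hpsi : c.psi t - 1 ∈ Icc (c.thetaB (9 / 10)) (c.thetaB 10⁻¹) := by
    constructor
    · have a1 : c.thetaB (9 / 10) ≤ c.thetaB (4 / 5) := c.strictAntiOn_thetaB.antitoneOn (by norm_num) (by norm_num) (by norm_num)
      have a2 : c.psi c.thi ≤ c.psi t := c.strictMono_psi.monotone (by linarith [ht.1])
      rw [c.psi_thi] at a2; linarith
    · have a1 : c.thetaB (13 / 20) ≤ c.thetaB 10⁻¹ := c.strictAntiOn_thetaB.antitoneOn (by norm_num) (by norm_num) (by norm_num)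
      have a2 : c.psi t ≤ c.psi (c.psiInv (c.thetaB (13 / 20) + 1)) := c.strictMono_psi.monotone (by linarith [ht.2, hm.2])
      rw [c.psi_psiInv] at a2; linarith
  have h3 : 1 - P.du.H₁ (-t) = c.gUp t := by rw [h1, gUpR, neg_neg]; ring
  rw [θPmid, θPup, show 2 * π + c.ΘB (1 - P.du.H₁ (-t)) - P.φ = 2 * π + c.ΘB (c.gUp t) - P.φ by rw [h3], h2,
    c.ΘB_heightB hpsi]
  ring

/-! ### Local representations of the lift -/

/-- `θP_eventuallyEq_lo` (auxiliary). [folklore] -/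
theorem θP_eventuallyEq_lo {t₀ : ℝ} (ht₀ : t₀ ≤ c.tlo - c.epsLo) : P.θP =ᶠ[𝓝 t₀] P.θPlo := by
  have hε := c.epsLo_pos'
  have hn : Iio (c.tlo - c.epsLo / 4) ∈ 𝓝 t₀ := Iio_mem_nhds (by linarith)
  filter_upwards [hn] with t ht
  rw [θP]
  split_ifs with h1 h2
  · rfl
  · exact (P.θPlo_eq_θPmid ⟨by linarith [lt_of_not_ge h1], by linarith [mem_Iio.1 ht]⟩).symm
  · exfalso; obtain ⟨-, -, -, h34, -⟩ := c.marks_lt; have := c.epsHi_bounds.1; linarith [lt_of_not_ge h2, mem_Iio.1 ht]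

/-- `θP_eventuallyEq_mid` (auxiliary). [folklore] -/
theorem θP_eventuallyEq_mid {t₀ : ℝ} (ht₀ : t₀ ∈ Icc (c.tlo - c.epsLo) (c.thi + c.epsHi)) : P.θP =ᶠ[𝓝 t₀] P.θPmid := by
  have hε := c.epsLo_pos'; have hε' := c.epsHi_bounds.1
  have hn : Ioo (c.tlo - 3 * c.epsLo / 2) (c.thi + 3 * c.epsHi / 2) ∈ 𝓝 t₀ :=
    Ioo_mem_nhds (by linarith [ht₀.1]) (by linarith [ht₀.2])
  filter_upwards [hn] with t ht
  rw [θP]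
  split_ifs with h1 h2
  · exact P.θPlo_eq_θPmid ⟨ht.1.le, by linarith⟩
  · rfl
  · exact (P.θPmid_eq_θPup ⟨by linarith [lt_of_not_ge h2], ht.2.le⟩).symm

/-- `θP_eventuallyEq_up` (auxiliary). [folklore] -/
theorem θP_eventuallyEq_up {t₀ : ℝ} (ht₀ : c.thi + c.epsHi ≤ t₀) : P.θP =ᶠ[𝓝 t₀] P.θPup := by
  have hε := c.epsLo_pos'; have hε' := c.epsHi_bounds.1
  have hn : Ioi (c.thi + c.epsHi / 4) ∈ 𝓝 t₀ := Ioi_mem_nhds (by linarith)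
  filter_upwards [hn] with t ht
  have ht' : c.thi + c.epsHi / 4 < t := ht
  rw [θP]
  split_ifs with h1 h2
  · exfalso; obtain ⟨-, -, -, h34, -⟩ := c.marks_lt; linarith
  · exact P.θPmid_eq_θPup ⟨ht'.le, by linarith⟩
  · rfl

/-! ### The derivative of the lift is positive -/

/-- End of the lower track: `θPlo' = ΘB' (H₁) · H₁' > 0` on `[t_L, tlo - ε/4]`. [folklore] -/
theorem hasDerivAt_θPlo {t : ℝ} (ht : t ∈ Icc P.dl.tL (c.tlo - c.epsLo / 4)) :
    HasDerivAt P.θPlo (deriv c.ΘB (P.dl.H₁ t) * deriv P.dl.H₁ t) t ∧ 0 < deriv c.ΘB (P.dl.H₁ t) * deriv P.dl.H₁ t := by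
  have hε := c.epsLo_pos'
  have htL := P.tL_mem
  have hH : P.dl.H₁ t ∈ Ioo (10⁻¹ : ℝ) (9 / 10) := by
    have h := P.dl.H₁_mem_Ioo (t := t) (by rw [dl_a, dl_b, dl_ε]; exact ⟨by linarith [ht.1, htL.1, c.alo_add_lt_tlo_sub], by linarith [ht.2]⟩)
    exact ⟨h.1, by linarith [h.2]⟩
  have hH' : deriv P.dl.H₁ t < 0 := P.dl.deriv_H₁_neg ⟨ht.1, by rw [dl_b, dl_ε]; linarith [ht.2]⟩
  have hΘ' := c.deriv_ΘB_neg hH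
  refine ⟨?_, mul_pos_of_neg_of_neg hΘ' hH'⟩
  have hH₁ : HasDerivAt P.dl.H₁ (deriv P.dl.H₁ t) t := (P.dl.contDiff_H₁.differentiable (by simp) t).hasDerivAt
  have h := (c.hasDerivAt_ΘB hH).comp t hH₁
  have : P.θPlo = fun s ↦ c.ΘB (P.dl.H₁ s) - P.φ := rfl
  rw [this]; exact h.sub_const _

/-- The `B`-piece: `θPmid' = 2π λ_c > 0`. [folklore] -/
theorem hasDerivAt_θPmid (t : ℝ) : HasDerivAt P.θPmid (2 * π * c.lam) t ∧ 0 < 2 * π * c.lam := by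
  refine ⟨?_, by have := c.lam_pos; positivity⟩
  have : P.θPmid = fun s ↦ 2 * π * c.psi s - P.φ := rfl
  rw [this]; exact ((c.hasDerivAt_psi t).const_mul (2 * π)).sub_const _

/-- Start of the upper track: `θPup' = ΘB' (1 - H₁ᵘ (-t)) · (H₁ᵘ)' (-t) > 0` on `[thi + ε'/4, t_Lᵘ']`. [folklore] -/
theorem hasDerivAt_θPup {t : ℝ} (ht : t ∈ Icc (c.thi + c.epsHi / 4) P.tLu') :
    HasDerivAt P.θPup (deriv c.ΘB (1 - P.du.H₁ (-t)) * deriv P.du.H₁ (-t)) t ∧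
      0 < deriv c.ΘB (1 - P.du.H₁ (-t)) * deriv P.du.H₁ (-t) := by
  have hε := c.epsHi_bounds.1
  have htL := P.tLu'_mem
  have hH : P.du.H₁ (-t) ∈ Ioo (10⁻¹ : ℝ) 2⁻¹ :=
    P.du.H₁_mem_Ioo (t := -t) (by rw [du_a, du_b, du_ε]; exact ⟨by linarith [ht.2, htL.2, c.thi_add_lt_ahi_sub], by linarith [ht.1]⟩)
  have hH1 : 1 - P.du.H₁ (-t) ∈ Ioo (10⁻¹ : ℝ) (9 / 10) := ⟨by linarith [hH.2], by linarith [hH.1]⟩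
  have hH' : deriv P.du.H₁ (-t) < 0 :=
    P.du.deriv_H₁_neg ⟨by rw [tLu'] at ht; linarith [ht.2], by rw [du_b, du_ε]; linarith [ht.1]⟩
  have hΘ' := c.deriv_ΘB_neg hH1
  refine ⟨?_, mul_pos_of_neg_of_neg hΘ' hH'⟩
  have hH₁ : HasDerivAt P.du.H₁ (deriv P.du.H₁ (-t)) (-t) := (P.du.contDiff_H₁.differentiable (by simp) (-t)).hasDerivAt
  have hin : HasDerivAt (fun s ↦ 1 - P.du.H₁ (-s)) (0 - deriv P.du.H₁ (-t) * -1) t :=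
    (hasDerivAt_const t (1 : ℝ)).sub (hH₁.comp t (hasDerivAt_neg t))
  have h := (c.hasDerivAt_ΘB hH1).comp t hin
  have : P.θPup = fun s ↦ 2 * π + c.ΘB (1 - P.du.H₁ (-s)) - P.φ := rfl
  rw [this]
  have e1 : deriv c.ΘB (1 - P.du.H₁ (-t)) * deriv P.du.H₁ (-t) = deriv c.ΘB (1 - P.du.H₁ (-t)) * (0 - deriv P.du.H₁ (-t) * -1) := by
    ring
  rw [e1]
  exact (h.const_add (2 * π)).sub_const P.φ

/-- **The lift has positive derivative on `[t_L, t_Lᵘ']`.** [folklore] -/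
theorem exists_hasDerivAt_θP_pos {t : ℝ} (ht : t ∈ Icc P.dl.tL P.tLu') :
    ∃ g : ℝ → ℝ, ∃ g' : ℝ, P.θP =ᶠ[𝓝 t] g ∧ HasDerivAt g g' t ∧ 0 < g' := by
  have hε := c.epsLo_pos'; have hε' := c.epsHi_bounds.1
  obtain ⟨-, -, -, h34, -⟩ := c.marks_lt
  have htL := P.tL_mem; have htLu := P.tLu'_mem
  rcases le_or_gt t (c.tlo - c.epsLo) with h1 | h1
  · obtain ⟨hd, hpos⟩ := P.hasDerivAt_θPlo (t := t) ⟨ht.1, by linarith⟩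
    exact ⟨_, _, P.θP_eventuallyEq_lo h1, hd, hpos⟩
  rcases le_or_gt t (c.thi + c.epsHi) with h2 | h2
  · obtain ⟨hd, hpos⟩ := P.hasDerivAt_θPmid t
    exact ⟨_, _, P.θP_eventuallyEq_mid ⟨h1.le, h2⟩, hd, hpos⟩
  · obtain ⟨hd, hpos⟩ := P.hasDerivAt_θPup (t := t) ⟨by linarith, ht.2⟩
    exact ⟨_, _, P.θP_eventuallyEq_up h2.le, hd, hpos⟩

/-- `hasDerivAt_θP` (auxiliary). [folklore] -/
theorem hasDerivAt_θP {t : ℝ} (ht : t ∈ Icc P.dl.tL P.tLu') : HasDerivAt P.θP (deriv P.θP t) t ∧ 0 < deriv P.θP t := by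
  obtain ⟨g, g', hg, hd, hpos⟩ := P.exists_hasDerivAt_θP_pos ht
  have h : HasDerivAt P.θP g' t := hd.congr_of_eventuallyEq hg
  rw [h.deriv]; exact ⟨h, hpos⟩

/-- **The lift is strictly increasing on `[t_L, t_Lᵘ']`.** [folklore] -/
theorem strictMonoOn_θP : StrictMonoOn P.θP (Icc P.dl.tL P.tLu') := by
  refine strictMonoOn_of_deriv_pos (convex_Icc _ _) (fun t ht ↦ (P.hasDerivAt_θP ht).1.continuousAt.continuousWithinAt) ?_
  intro t ht; rw [interior_Icc] at ht
  exact (P.hasDerivAt_θP (Ioo_subset_Icc_self ht)).2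

/-! ### The two ends -/

/-- `tL_lt_tLu'` (auxiliary). [folklore] -/
theorem tL_lt_tLu' : P.dl.tL < P.tLu' := by
  have h1 := P.tL_mem.2; have h2 := P.tLu'_mem.1; obtain ⟨-, -, -, h34, -⟩ := c.marks_lt
  have := c.epsLo_pos'; have := c.epsHi_bounds.1; linarith

/-- At the lower landing the lift is the lower route angle. [folklore] -/
theorem θP_tL : P.θP P.dl.tL = (P.routeHypLo he).θ P.dl.tL := by
  have h : P.θP P.dl.tL = P.θPlo P.dl.tL := by
    rw [θP, if_pos (by linarith [P.tL_mem.2, c.epsLo_pos'])]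
  rw [h]; rfl

/-- At the upper landing the lift is `2π` minus the upper route angle. [folklore] -/
theorem θP_tLu' : P.θP P.tLu' = 2 * π - (P.routeHypUp he).θ P.du.tL := by
  have hε := c.epsLo_pos'; have hε' := c.epsHi_bounds.1
  obtain ⟨-, -, -, h34, -⟩ := c.marks_lt
  have htLu := P.tLu'_mem
  have h : P.θP P.tLu' = P.θPup P.tLu' := by
    rw [θP, if_neg (by linarith [htLu.1]), if_neg (by linarith [htLu.1])]
  rw [h, θPup]
  show 2 * π + c.ΘB (1 - P.du.H₁ (- -P.du.tL)) - P.φ = 2 * π - P.Θup (P.du.H₁ P.du.tL)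
  rw [neg_neg, Θup]; ring

/-- The lower end angle lies in `(0, π)`. [folklore] -/
theorem θ₁_mem : (P.routeHypLo he).θ P.dl.tL ∈ Ioo 0 π :=
  ⟨(P.routeHypLo he).θ_pos ⟨P.dl.tD_lt_tL.le, le_rfl⟩, ((P.routeHypLo he).θ_mem_Ioo ⟨P.dl.tD_lt_tL.le, le_rfl⟩).2⟩

/-- `θ₁u_mem` (auxiliary). [folklore] -/
theorem θ₁u_mem : (P.routeHypUp he).θ P.du.tL ∈ Ioo 0 π :=
  ⟨(P.routeHypUp he).θ_pos ⟨P.du.tD_lt_tL.le, le_rfl⟩, ((P.routeHypUp he).θ_mem_Ioo ⟨P.du.tD_lt_tL.le, le_rfl⟩).2⟩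

/-- **The range of the lift**: `θP t ∈ [θ₁, 2π - θ₁ᵘ]` on `[t_L, t_Lᵘ']`. [folklore] -/
theorem θP_mem {t : ℝ} (ht : t ∈ Icc P.dl.tL P.tLu') :
    P.θP t ∈ Icc ((P.routeHypLo he).θ P.dl.tL) (2 * π - (P.routeHypUp he).θ P.du.tL) := by
  rw [← P.θP_tL he, ← P.θP_tLu' he]
  have hm := (P.strictMonoOn_θP).monotoneOn
  have hlt := P.tL_lt_tLu'
  exact ⟨hm (left_mem_Icc.2 hlt.le) ht ht.1, hm ht (right_mem_Icc.2 hlt.le) ht.2⟩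

/-- **Past the vertical at the lower landing**: the twisted abscissa is negative. [folklore] -/
theorem sliceX_tL_neg : sliceX P.tw 1 (cos ((P.routeHypLo he).θ P.dl.tL)) (sin ((P.routeHypLo he).θ P.dl.tL)) < 0 := by
  set R := P.routeHypLo he
  have hθ := (R.θ_mem_Ioo ⟨P.dl.tD_lt_tL.le, le_rfl⟩)
  rw [sliceX_cos_sin (c := P.tw) (r := 1) hθ, one_mul]
  have hα := R.α_tL_mem
  have hs := R.s_le_half
  have e1 : twistAngle P.tw 1 (R.θ P.dl.tL) = R.α P.dl.tL := by
    show twistAngle P.tw 1 (R.θ P.dl.tL) = twistAngle R.c (R.r P.dl.tL) (R.θ P.dl.tL)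
    rw [R.r_tL]; rfl
  rw [e1]
  exact cos_neg_of_pi_div_two_lt_of_lt hα.1 (by linarith [hα.2, pi_gt_three])

/-- `sliceX_tLu_neg` (auxiliary). [folklore] -/
theorem sliceX_tLu_neg : sliceX P.tw 1 (cos (2 * π - (P.routeHypUp he).θ P.du.tL)) (sin (2 * π - (P.routeHypUp he).θ P.du.tL)) < 0 := by
  set R := P.routeHypUp he
  have hθ := (R.θ_mem_Ioo ⟨P.du.tD_lt_tL.le, le_rfl⟩)
  rw [cos_two_pi_sub]
  -- `sliceX` does not depend on the second coordinate
  have e0 : sliceX P.tw 1 (cos (R.θ P.du.tL)) (sin (2 * π - R.θ P.du.tL)) = sliceX P.tw 1 (cos (R.θ P.du.tL)) (sin (R.θ P.du.tL)) := rfl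
  rw [e0, sliceX_cos_sin (c := P.tw) (r := 1) hθ, one_mul]
  have hα := R.α_tL_mem
  have hs := R.s_le_half
  have e1 : twistAngle P.tw 1 (R.θ P.du.tL) = R.α P.du.tL := by
    show twistAngle P.tw 1 (R.θ P.du.tL) = twistAngle R.c (R.r P.du.tL) (R.θ P.du.tL)
    rw [R.r_tL]; rfl
  rw [e1]
  exact cos_neg_of_pi_div_two_lt_of_lt hα.1 (by linarith [hα.2, pi_gt_three])

/-- **The far side lies in the left half-plane of the twisted chart.** [cite: Kirby1989, Ch. I §4] -/
theorem sliceX_θP_neg (he : ContDiffOn ℝ ∞ e (Ioo (10⁻¹ : ℝ) (9 / 10))) {t : ℝ} (ht : t ∈ Icc P.dl.tL P.tLu') :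
    sliceX P.tw 1 (cos (P.θP t)) (sin (P.θP t)) < 0 := by
  have hm := P.θP_mem he ht
  have h1 := P.θ₁_mem he; have h2 := P.θ₁u_mem he
  exact sliceX_pushOff_neg_of_ends P.tw (P.sliceX_tL_neg he) (P.sliceX_tLu_neg he)
    (cos_le_max_of_mem_arc h1.1.le hm.1 hm.2 (by linarith [h2.1]))

/-! ### The twisted height on the far side -/

/-- **The twisted height along the far side of the push-off.** [folklore] -/
def yP (t : ℝ) : ℝ := sliceY P.tw 1 (cos (P.θP t)) (sin (P.θP t))

/-- **The height decreases along the far side**: negative derivative and strict decrease on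
`[t_L, t_Lᵘ']`. [cite: Kirby1989, Ch. I §4] -/
theorem yP_strictAnti (he : ContDiffOn ℝ ∞ e (Ioo (10⁻¹ : ℝ) (9 / 10))) :
    (∀ t ∈ Icc P.dl.tL P.tLu', HasDerivAt P.yP (deriv P.yP t) t ∧ deriv P.yP t < 0) ∧
    StrictAntiOn P.yP (Icc P.dl.tL P.tLu') := by
  apply strictAntiOn_of_local_pieces
  intro t ht
  obtain ⟨g, g', hg, hd, hpos⟩ := P.exists_hasDerivAt_θP_pos ht
  refine ⟨fun s ↦ sliceY P.tw 1 (cos (g s)) (sin (g s)), _, ?_, (hasDerivAt_sliceY_pushOff P.tw hd), ?_⟩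
  · filter_upwards [hg] with s hs
    show sliceY P.tw 1 (cos (P.θP s)) (sin (P.θP s)) = sliceY P.tw 1 (cos (g s)) (sin (g s))
    rw [hs]
  · have h := deriv_sliceY_pushOff_neg P.tw hd hpos (by rw [← hg.self_of_nhds]; exact P.sliceX_θP_neg he ht)
    rwa [(hasDerivAt_sliceY_pushOff P.tw hd).deriv] at h

end SlideChoice

end BandCore

end Literature.Topology.FourManifolds
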